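import Summits.QuantumFields.BalabanUV.Beta.JetCoefficientCauchy

/-!
# Beta / ConjReflectionAlgebra — KERNEL side of the `hsym` binder of `Beta/CapRowsQhalf` (R62-c): the conjugate-reflection symmetry
# `G(−p̄) = conj G(p)` on COMPLEX momenta, closed under every operation of `Beta/PolyRegularAlgebra` §2–§3, for one-slot families, for
# THREE-SLOT jet integrands `f(q; p₁, p₂)`, and for the JET FUNCTIONAL of `Beta/JetCoefficientCauchy` (β sub-cell, CAP lane; unit
# `b2b-balaban-beta-num` gen 12 — the «40-line sibling of `PolyRegularAlgebra`» an5-g20 specified, journal l.3965 ∕ l.4013, cap3-g9 l.4356 (4))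

`CapRowsQhalf.rowsOfCode16E_ofRealBall` lets a PAIRED (q ∕ −q) certified total instantiate the `hT` binder of `rowsOfCode16E` under ONE
structural hypothesis on the typed integrand, `hsym : ∀ p : ℝ^{d+1}, G (ofRealVec (−p)) = conj (G (ofRealVec p))`.  This module discharges
`hsym` MODULO THE SAME (Z)-STRUCTURE READING the cell already uses for `MatPolyHol` (the engines' matrix families are not typed in Lean;
what is proved is: IF `G` is built by the listed operations from character sums with entrywise self-conjugate coefficient tables, THEN
`hsym`).  The symmetry is stated on complex momenta, `p ↦ −p̄ = conjNeg p`, because that form is closed under matrix inversion and under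
the jet extraction; on real momenta it IS `hsym` (`ConjSymm.hsym`) and it is the real-zone hypothesis of
`GAN24/LatticeKernelReality.latticeKernel_im_eq_zero` (`ConjSymm.realZone`).
§1 `conjNeg`.  §2 scalar families `ConjSymm G`: real constants, `I·p_i`, self-conjugate-frequency phases, `cexp`, the characters
`PolyRegularAlgebra.character x`, `add ∕ neg ∕ sub ∕ mul ∕ sum ∕ prod ∕ pow ∕ inv ∕ div`; `hsym`, `realZone`.  §3 matrix families `MatConjSymm A`
(`A(−p̄) = conj ∘ A(p)` entrywise): tables with `K.map conj = K` (real tables cast to `ℂ`), character sums against them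
(`matConjSymm_characterSum` — literally the expression of `matPolyHol_characterSum`), `add ∕ sub ∕ mul ∕ smul ∕ sum ∕ det ∕ trace`, the
INVERSE with NO determinant hypothesis; `conjSymm_trace_resolvent ∕ _bubble ∕ conjSymm_oneLoopForm`, `oneLoopForm_hsym` (an5's binder shape,
anchor `CapRowsLatticeJet.rowsOfOneLoopFormCode16E₂`).  §4 THREE-SLOT families `ConjSymm₃ f`, `MatConjSymm₃ A` — JOINT reflection
`(q; p₁, p₂) ↦ (−q̄; −p̄₁, −p̄₂)` — transport to one-slot families on `ι ⊕ Bool`, the generators of a jet integrand (q-only families, the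
SHIFTED family `q ↦ A(q − p₁v₁ − p₂v₂)` with real `v`'s = `k₀(q − p)`, the odd generators `I·p₁`, `I·p₂`, phases), closure,
`conjSymm₃_oneLoopForm`.  §5 `deriv (z ↦ conj h(−z̄)) z = −conj h′(−z̄)` (Mathlib `deriv_conj_conj` + `deriv_comp_neg`, unconditional),
hence **`conjSymm_jetFunctional : ConjSymm₃ f → ConjSymm (jetFunctional f)`** (the two sign flips of the two `p`-derivatives cancel) and
**`jet_hsym`** = an5's binder verbatim for `G := jetFunctional f` (anchor `CapRowsLatticeJet.rowsOfJetCode16E₂`).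
CAVEAT, ON PURPOSE.  The un-differentiated one-loop form at a FIXED real source momentum `p ≠ 0` (shifted family `A′ = k₀(· − p)`) is NOT
`q ↦ −q̄` symmetric (reflection sends `k₀(q − p)` to `k₀(q + p)`); only the JOINT reflection of `(q, p)` is a symmetry, and the
`[p₁p₂]`-coefficient inherits `q ↦ −q̄` symmetry because it is EVEN in `p` (§5) — consistent with cap3-g9's float ∕ paper reading l.4356 (4)
(«even momentum labels REAL, odd purely IMAGINARY») and cap5's exact parity counts, neither of which is used here.
HONEST FRAMING.  Kernel algebra only ([folklore] linear algebra + one line of complex calculus over Mathlib; 0 `sorry`, 0 cite tags, no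
`Prop` restating any statement of Bałaban's; the four `def … : Prop` are parametrised predicates): no number of the β-function, no
certificate, no row, no binder INSTANCE — composing these lemmas into `Rows b` constructors is the row owner's (an5) call.  Discharging
`BetaPertH` would make Bałaban's ultraviolet stability UNCONDITIONAL — NOT the continuum limit and NOT the Clay problem.  HONEST DEPENDENCY:
continuum YM on T⁴ ⇐ BetaPertH ∧ nine spine estimates (0/9 proved); BetaPertH ⇐ (D1) ∧ (D4) ∧ CAP+tail; G-an2-4 gates asym, D1 and NE2/3/4.
-/

noncomputable section

namespace Summit.QuantumFields.BalabanUV.Beta.ConjReflectionAlgebra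

open Complex
open Literature.MathematicalPhysics.QuantumFieldTheory.Balaban1983to89
open B4Strip (ofRealVec)
open B4ContourShift (BZ)
open Summit.QuantumFields.BalabanUV.Beta.PolyRegularAlgebra (character)
open Summit.QuantumFields.BalabanUV.Beta.JetCoefficientCauchy (jetFunctional)
open scoped ComplexConjugate

variable {ι : Type*}

/-! ## §1 The conjugate-reflected momentum `p ↦ −p̄` -/

/-- `conjNeg p = −p̄`, coordinatewise. [folklore] -/
def conjNeg (p : ι → ℂ) : ι → ℂ := fun i => -conj (p i)

/-- coordinate formula `(−p̄)_i = −conj p_i`. [folklore] -/ @[simp] theorem conjNeg_apply (p : ι → ℂ) (i : ι) : conjNeg p i = -conj (p i) := rfl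

/-- `−(−p̄)‾ = p`. [folklore] -/
theorem conjNeg_conjNeg (p : ι → ℂ) : conjNeg (conjNeg p) = p := by
  funext i; simp [conjNeg]

/-- on REAL momenta conjugate reflection is plain reflection: `conjNeg (ofRealVec s) = ofRealVec (−s)`. [folklore] -/
theorem conjNeg_ofRealVec {k : ℕ} (s : Fin k → ℝ) : conjNeg (ofRealVec s) = ofRealVec (-s) := by
  funext i; simp [conjNeg, ofRealVec, Complex.conj_ofReal]

/-! ## §2 Scalar families: `ConjSymm G := ∀ p, G (−p̄) = conj (G p)` -/

/-- CONJUGATE-REFLECTION SYMMETRY of a scalar family on complex momenta. [folklore] -/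
def ConjSymm (G : (ι → ℂ) → ℂ) : Prop := ∀ p, G (conjNeg p) = conj (G p)

section Scalar

variable {G G₁ G₂ F : (ι → ℂ) → ℂ}

/-- self-conjugate constants. [folklore] -/
theorem conjSymm_const {c : ℂ} (hc : conj c = c) : ConjSymm (fun _ : ι → ℂ => c) := fun _ => hc.symm

/-- real constants. [folklore] -/
theorem conjSymm_ofReal (r : ℝ) : ConjSymm (fun _ : ι → ℂ => (r : ℂ)) := conjSymm_const (Complex.conj_ofReal r)

/-- the ODD generator made even: `p ↦ I · p_i`. [folklore] -/
theorem conjSymm_I_mul_coord (i : ι) : ConjSymm (fun p : ι → ℂ => I * p i) := fun p => by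
  simp only [conjNeg_apply, map_mul, Complex.conj_I]; ring

/-- linear phases `p ↦ I · Σ_i x_i p_i` with self-conjugate (real, e.g. integer or half-integer) frequencies. [folklore] -/
theorem conjSymm_phase [Fintype ι] {x : ι → ℂ} (hx : ∀ i, conj (x i) = x i) :
    ConjSymm (fun p : ι → ℂ => I * ∑ i, x i * p i) := fun p => by
  simp only [conjNeg_apply, map_mul, map_sum, Complex.conj_I, hx, mul_neg, Finset.sum_neg_distrib, neg_mul]

/-- `cexp` preserves the symmetry. [folklore] -/
theorem ConjSymm.cexp (h : ConjSymm G) : ConjSymm (fun p => cexp (G p)) := fun p => by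
  simp only [h p]; exact Complex.exp_conj (G p)

/-- the LATTICE CHARACTERS `e^{i x·p}` of `PolyRegularAlgebra` (integer frequencies). [folklore] -/
theorem conjSymm_character {d : ℕ} (x : Fin (d + 1) → ℤ) : ConjSymm (character x) :=
  (conjSymm_phase (x := fun μ => (x μ : ℂ)) fun _ => map_intCast _ _).cexp

/-- sums. [folklore] -/ theorem ConjSymm.add (h₁ : ConjSymm G₁) (h₂ : ConjSymm G₂) : ConjSymm (fun p => G₁ p + G₂ p) := fun p => by
  simp only [h₁ p, h₂ p, map_add]
/-- negations. [folklore] -/ theorem ConjSymm.neg (h : ConjSymm G) : ConjSymm (fun p => -G p) := fun p => by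
  simp only [h p, map_neg]
/-- differences. [folklore] -/ theorem ConjSymm.sub (h₁ : ConjSymm G₁) (h₂ : ConjSymm G₂) : ConjSymm (fun p => G₁ p - G₂ p) := fun p => by
  simp only [h₁ p, h₂ p, map_sub]
/-- products. [folklore] -/ theorem ConjSymm.mul (h₁ : ConjSymm G₁) (h₂ : ConjSymm G₂) : ConjSymm (fun p => G₁ p * G₂ p) := fun p => by
  simp only [h₁ p, h₂ p, map_mul]

/-- finite sums. [folklore] -/ theorem ConjSymm.sum {α : Type*} (s : Finset α) {H : α → (ι → ℂ) → ℂ} (h : ∀ a ∈ s, ConjSymm (H a)) :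
    ConjSymm (fun p => ∑ a ∈ s, H a p) := fun p => by
  rw [map_sum]; exact Finset.sum_congr rfl fun a ha => h a ha p
/-- finite products. [folklore] -/ theorem ConjSymm.prod {α : Type*} (s : Finset α) {H : α → (ι → ℂ) → ℂ} (h : ∀ a ∈ s, ConjSymm (H a)) :
    ConjSymm (fun p => ∏ a ∈ s, H a p) := fun p => by
  rw [map_prod]; exact Finset.prod_congr rfl fun a ha => h a ha p
/-- natural powers. [folklore] -/ theorem ConjSymm.pow (h : ConjSymm G) (k : ℕ) : ConjSymm (fun p => G p ^ k) := fun p => by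
  simp only [h p, map_pow]

/-- INVERSES — no non-vanishing hypothesis (`conj 0⁻¹ = 0⁻¹`). [folklore] -/
theorem ConjSymm.inv (h : ConjSymm F) : ConjSymm (fun p => (F p)⁻¹) := fun p => by
  simp only [h p, map_inv₀]
/-- quotients — no non-vanishing hypothesis. [folklore] -/ theorem ConjSymm.div (h₁ : ConjSymm G) (h₂ : ConjSymm F) : ConjSymm (fun p => G p / F p) := fun p => by
  simp only [h₁ p, h₂ p, map_div₀]

/-- **`hsym`** — the binder of `CapRowsQhalf.descend_neg ∕ rowsOfCode16E_ofRealBall`, verbatim shape: on REAL momenta the symmetry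
reads `G (ofRealVec (−p)) = conj (G (ofRealVec p))`. [folklore] -/
theorem ConjSymm.hsym {k : ℕ} {G : (Fin k → ℂ) → ℂ} (h : ConjSymm G) :
    ∀ p : Fin k → ℝ, G (ofRealVec (-p)) = conj (G (ofRealVec p)) := fun p => by
  rw [← conjNeg_ofRealVec]; exact h _

/-- the REAL-ZONE form consumed by `GAN24/LatticeKernelReality.latticeKernel_im_eq_zero` (reality of the lattice kernel). [folklore] -/
theorem ConjSymm.realZone {d : ℕ} {G : (Fin (d + 1) → ℂ) → ℂ} (h : ConjSymm G) :
    ∀ s ∈ BZ (d + 1), conj (G (ofRealVec (-s))) = G (ofRealVec s) := fun s _ => by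
  rw [h.hsym s, Complex.conj_conj]

end Scalar

/-! ## §3 Matrix families: `MatConjSymm A := ∀ p, A (−p̄) = (A p).map conj` -/

section Matrix

variable {m n : Type*} {A A' B C D : (ι → ℂ) → Matrix n n ℂ}

/-- CONJUGATE-REFLECTION SYMMETRY of a matrix family (entrywise). [folklore] -/
def MatConjSymm (A : (ι → ℂ) → Matrix m n ℂ) : Prop := ∀ p, A (conjNeg p) = (A p).map conj

/-- `MatConjSymm A` iff every entry family is `ConjSymm`. [folklore] -/ theorem matConjSymm_iff {A : (ι → ℂ) → Matrix m n ℂ} : MatConjSymm A ↔ ∀ i j, ConjSymm (fun p => A p i j) := by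
  constructor
  · intro h i j p; simp only [h p, Matrix.map_apply]
  · intro h p; ext i j; simp only [Matrix.map_apply]; exact h i j p

/-- each entry of a `MatConjSymm` family is `ConjSymm`. [folklore] -/ theorem MatConjSymm.entry {A : (ι → ℂ) → Matrix m n ℂ} (hA : MatConjSymm A) (i : m) (j : n) :
    ConjSymm (fun p => A p i j) := matConjSymm_iff.mp hA i j

/-- constant families with self-conjugate entries. [folklore] -/
theorem matConjSymm_const {K : Matrix m n ℂ} (hK : K.map conj = K) : MatConjSymm (fun _ : ι → ℂ => K) := fun _ => hK.symm

/-- a REAL table cast to `ℂ` is self-conjugate. [folklore] -/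
theorem map_conj_of_real (K : Matrix m n ℝ) : (K.map ((↑) : ℝ → ℂ)).map conj = K.map ((↑) : ℝ → ℂ) := by
  ext i j; simp only [Matrix.map_apply, Complex.conj_ofReal]

/-- constant REAL tables cast to `ℂ`. [folklore] -/ theorem matConjSymm_realConst (K : Matrix m n ℝ) : MatConjSymm (fun _ : ι → ℂ => K.map ((↑) : ℝ → ℂ)) :=
  matConjSymm_const (map_conj_of_real K)

/-- sums of matrix families. [folklore] -/ theorem MatConjSymm.add {A B : (ι → ℂ) → Matrix m n ℂ} (hA : MatConjSymm A) (hB : MatConjSymm B) :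
    MatConjSymm (fun p => A p + B p) :=
  matConjSymm_iff.mpr fun i j => by simpa only [Matrix.add_apply] using (hA.entry i j).add (hB.entry i j)
/-- negations of matrix families. [folklore] -/ theorem MatConjSymm.neg {A : (ι → ℂ) → Matrix m n ℂ} (hA : MatConjSymm A) : MatConjSymm (fun p => -A p) :=
  matConjSymm_iff.mpr fun i j => by simpa only [Matrix.neg_apply] using (hA.entry i j).neg
/-- differences of matrix families. [folklore] -/ theorem MatConjSymm.sub {A B : (ι → ℂ) → Matrix m n ℂ} (hA : MatConjSymm A) (hB : MatConjSymm B) :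
    MatConjSymm (fun p => A p - B p) :=
  matConjSymm_iff.mpr fun i j => by simpa only [Matrix.sub_apply] using (hA.entry i j).sub (hB.entry i j)

/-- scalar-family multiples `g p • A p`. [folklore] -/
theorem MatConjSymm.smul {A : (ι → ℂ) → Matrix m n ℂ} (hA : MatConjSymm A) {g : (ι → ℂ) → ℂ} (hg : ConjSymm g) :
    MatConjSymm (fun p => g p • A p) :=
  matConjSymm_iff.mpr fun i j => by simpa only [Matrix.smul_apply, smul_eq_mul] using hg.mul (hA.entry i j)

/-- finite sums of matrix families. [folklore] -/ theorem MatConjSymm.sum {α : Type*} (s : Finset α) {H : α → (ι → ℂ) → Matrix m n ℂ} (h : ∀ a ∈ s, MatConjSymm (H a)) :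
    MatConjSymm (fun p => ∑ a ∈ s, H a p) :=
  matConjSymm_iff.mpr fun i j => by
    simpa only [Matrix.sum_apply] using ConjSymm.sum s fun a ha => (h a ha).entry i j

/-- sums `p ↦ Σ_{a ∈ s} φ_a(p) • K_a` of symmetric scalar families against self-conjugate tables. [folklore] -/
theorem matConjSymm_sum_smul {α : Type*} (s : Finset α) {φ : α → (ι → ℂ) → ℂ} {K : α → Matrix m n ℂ}
    (hφ : ∀ a ∈ s, ConjSymm (φ a)) (hK : ∀ a ∈ s, (K a).map conj = K a) :
    MatConjSymm (fun p => ∑ a ∈ s, φ a p • K a) :=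
  MatConjSymm.sum s fun a ha => (matConjSymm_const (hK a ha)).smul (hφ a ha)

/-- **CHARACTER SUMS WITH ENTRYWISE-REAL (self-conjugate) COEFFICIENT TABLES** `q ↦ Σ_{x ∈ S} e^{i x·q} • K x` — literally the
expression of `PolyRegularAlgebra.matPolyHol_characterSum`, the shape of every engine stencil family — are conjugate-reflection
symmetric. [folklore] -/
theorem matConjSymm_characterSum {d : ℕ} (S : Finset (Fin (d + 1) → ℤ)) (K : (Fin (d + 1) → ℤ) → Matrix m n ℂ)
    (hK : ∀ x ∈ S, (K x).map conj = K x) : MatConjSymm (fun p => ∑ x ∈ S, character x p • K x) :=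
  matConjSymm_sum_smul S (fun x _ => conjSymm_character x) hK

/-- products of (rectangular) matrix families. [folklore] -/ theorem MatConjSymm.mul [Fintype n] {o : Type*} {A : (ι → ℂ) → Matrix m n ℂ} {B : (ι → ℂ) → Matrix n o ℂ}
    (hA : MatConjSymm A) (hB : MatConjSymm B) : MatConjSymm (fun p => A p * B p) :=
  matConjSymm_iff.mpr fun i j => by
    simpa only [Matrix.mul_apply] using ConjSymm.sum Finset.univ fun k _ => (hA.entry i k).mul (hB.entry k j)

/-- the trace of a `MatConjSymm` family is `ConjSymm`. [folklore] -/ theorem MatConjSymm.trace [Fintype n] (hA : MatConjSymm A) : ConjSymm (fun p => (A p).trace) := by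
  simpa only [Matrix.trace, Matrix.diag_apply] using ConjSymm.sum Finset.univ fun i _ => hA.entry i i

/-- the determinant of a `MatConjSymm` family is `ConjSymm`. [folklore] -/ theorem MatConjSymm.det [Fintype n] [DecidableEq n] (hA : MatConjSymm A) : ConjSymm (fun p => (A p).det) := fun p => by
  simp only [hA p, RingHom.map_det, RingHom.mapMatrix_apply]

/-- **THE INVERSE** — Mathlib's total matrix inverse commutes with entrywise conjugation, so NO `det ≠ 0` hypothesis is needed
(contrast `MatPolyHol.inv`, where holomorphy genuinely needs (Z1)). [folklore] -/
theorem MatConjSymm.inv [Fintype n] [DecidableEq n] (hA : MatConjSymm A) : MatConjSymm (fun p => (A p)⁻¹) := fun p => by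
  have key : ∀ M : Matrix n n ℂ, (M⁻¹).map conj = (M.map conj)⁻¹ := fun M => by
    have e : ∀ X : Matrix n n ℂ, X.map conj = X.conjTranspose.transpose := fun X => by
      ext i j; simp [Matrix.conjTranspose_apply]
    rw [e, e, Matrix.conjTranspose_nonsing_inv, Matrix.transpose_nonsing_inv]
  show (A (conjNeg p))⁻¹ = ((A p)⁻¹).map conj
  rw [hA p, key]

/-- the TADPOLE form `p ↦ tr((A p)⁻¹ B p)`. [folklore] -/
theorem conjSymm_trace_resolvent [Fintype n] [DecidableEq n] (hA : MatConjSymm A) (hB : MatConjSymm B) :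
    ConjSymm (fun p => ((A p)⁻¹ * B p).trace) :=
  (hA.inv.mul hB).trace

/-- the BUBBLE form `p ↦ tr((A p)⁻¹ C p (A′ p)⁻¹ D p)`. [folklore] -/
theorem conjSymm_trace_bubble [Fintype n] [DecidableEq n] (hA : MatConjSymm A) (hA' : MatConjSymm A')
    (hC : MatConjSymm C) (hD : MatConjSymm D) : ConjSymm (fun p => ((A p)⁻¹ * C p * (A' p)⁻¹ * D p).trace) :=
  (((hA.inv.mul hC).mul hA'.inv).mul hD).trace

/-- the ONE-LOOP FORM `t₁ − t₂ = tr(A⁻¹ B) − tr(A⁻¹ C A′⁻¹ D)` — the expression of `PolyRegularAlgebra.stripRegularC_oneLoopForm` and of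
the anchor `CapRowsLatticeJet.rowsOfOneLoopFormCode16E₂`.  Mind the CAVEAT of the module docstring: a shifted family `A′ = A(· − p₀)` with
real `p₀ ≠ 0` is NOT `MatConjSymm`; use §4–§5 for the jet. [folklore] -/
theorem conjSymm_oneLoopForm [Fintype n] [DecidableEq n] (hA : MatConjSymm A) (hA' : MatConjSymm A') (hB : MatConjSymm B)
    (hC : MatConjSymm C) (hD : MatConjSymm D) :
    ConjSymm (fun p => ((A p)⁻¹ * B p).trace - ((A p)⁻¹ * C p * (A' p)⁻¹ * D p).trace) :=
  (conjSymm_trace_resolvent hA hB).sub (conjSymm_trace_bubble hA hA' hC hD)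

/-- … and its `hsym`, in an5's binder shape. [folklore] -/
theorem oneLoopForm_hsym {k : ℕ} [Fintype n] [DecidableEq n] {A A' B C D : (Fin k → ℂ) → Matrix n n ℂ} (hA : MatConjSymm A)
    (hA' : MatConjSymm A') (hB : MatConjSymm B) (hC : MatConjSymm C) (hD : MatConjSymm D) :
    ∀ p : Fin k → ℝ, (((A (ofRealVec (-p)))⁻¹ * B (ofRealVec (-p))).trace
        - ((A (ofRealVec (-p)))⁻¹ * C (ofRealVec (-p)) * (A' (ofRealVec (-p)))⁻¹ * D (ofRealVec (-p))).trace)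
      = conj ((((A (ofRealVec p))⁻¹ * B (ofRealVec p)).trace
        - ((A (ofRealVec p))⁻¹ * C (ofRealVec p) * (A' (ofRealVec p))⁻¹ * D (ofRealVec p)).trace)) :=
  (conjSymm_oneLoopForm hA hA' hB hC hD).hsym

end Matrix

/-! ## §4 Three-slot families `f(q; p₁, p₂)`: JOINT reflection `(q; p₁, p₂) ↦ (−q̄; −p̄₁, −p̄₂)` -/

section ThreeSlot

variable {m n : Type*}

/-- joint conjugate-reflection symmetry of a scalar jet integrand. [folklore] -/
def ConjSymm₃ (f : (ι → ℂ) → ℂ → ℂ → ℂ) : Prop := ∀ q p₁ p₂, f (conjNeg q) (-conj p₁) (-conj p₂) = conj (f q p₁ p₂)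

/-- joint conjugate-reflection symmetry of a matrix jet family. [folklore] -/
def MatConjSymm₃ (A : (ι → ℂ) → ℂ → ℂ → Matrix m n ℂ) : Prop :=
  ∀ q p₁ p₂, A (conjNeg q) (-conj p₁) (-conj p₂) = (A q p₁ p₂).map conj

/-- TRANSPORT: a three-slot family is a one-slot family on the index type `ι ⊕ Bool`. [folklore] -/
theorem conjSymm₃_iff {f : (ι → ℂ) → ℂ → ℂ → ℂ} :
    ConjSymm₃ f ↔ ConjSymm (fun P : ι ⊕ Bool → ℂ => f (fun i => P (.inl i)) (P (.inr true)) (P (.inr false))) :=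
  ⟨fun h _ => h _ _ _, fun h q p₁ p₂ => h (Sum.elim q fun b => cond b p₁ p₂)⟩

/-- transport: `MatConjSymm₃ A` iff the one-slot family on `ι ⊕ Bool` is `MatConjSymm`. [folklore] -/ theorem matConjSymm₃_iff {A : (ι → ℂ) → ℂ → ℂ → Matrix m n ℂ} :
    MatConjSymm₃ A ↔ MatConjSymm (fun P : ι ⊕ Bool → ℂ => A (fun i => P (.inl i)) (P (.inr true)) (P (.inr false))) :=
  ⟨fun h _ => h _ _ _, fun h q p₁ p₂ => h (Sum.elim q fun b => cond b p₁ p₂)⟩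

/-- `q`-only families. [folklore] -/
theorem ConjSymm.to₃ {G : (ι → ℂ) → ℂ} (h : ConjSymm G) : ConjSymm₃ (fun q _ _ => G q) := fun q _ _ => h q
/-- a `q`-only matrix family as a three-slot family. [folklore] -/ theorem MatConjSymm.to₃ {A : (ι → ℂ) → Matrix m n ℂ} (h : MatConjSymm A) : MatConjSymm₃ (fun q _ _ => A q) :=
  fun q _ _ => h q

/-- **THE SHIFTED FAMILY** `(q; p₁, p₂) ↦ A(q − p₁ v₁ − p₂ v₂)` with REAL direction vectors — the engines' `k₀(q − p)`,
`p = p₁ e_μ + p₂ e_ν` — is JOINTLY symmetric whenever `A` is. [folklore] -/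
theorem MatConjSymm.shift₃ {A : (ι → ℂ) → Matrix m n ℂ} (h : MatConjSymm A) (v₁ v₂ : ι → ℝ) :
    MatConjSymm₃ (fun q p₁ p₂ => A (fun i => q i - (v₁ i : ℂ) * p₁ - (v₂ i : ℂ) * p₂)) := fun q p₁ p₂ => by
  have e : (fun i => conjNeg q i - (v₁ i : ℂ) * -conj p₁ - (v₂ i : ℂ) * -conj p₂)
      = conjNeg (fun i => q i - (v₁ i : ℂ) * p₁ - (v₂ i : ℂ) * p₂) := by
    funext i; simp only [conjNeg_apply, map_sub, map_mul, Complex.conj_ofReal]; ring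
  show A _ = _
  rw [e, h]

/-- the odd generators made even: `I·p₁`, `I·p₂`. [folklore] -/
theorem conjSymm₃_I_mul_fst : ConjSymm₃ (fun (_ : ι → ℂ) p₁ _ => I * p₁) := fun _ _ _ => by
  simp only [map_mul, Complex.conj_I]; ring
/-- the odd generator `I·p₂`. [folklore] -/ theorem conjSymm₃_I_mul_snd : ConjSymm₃ (fun (_ : ι → ℂ) _ p₂ => I * p₂) := fun _ _ _ => by
  simp only [map_mul, Complex.conj_I]; ring

/-- real constants (three-slot). [folklore] -/ theorem conjSymm₃_ofReal (r : ℝ) : ConjSymm₃ (fun (_ : ι → ℂ) _ _ => (r : ℂ)) := fun _ _ _ => (Complex.conj_ofReal r).symm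

variable {f g : (ι → ℂ) → ℂ → ℂ → ℂ}

/-- three-slot sums. [folklore] -/ theorem ConjSymm₃.add (hf : ConjSymm₃ f) (hg : ConjSymm₃ g) : ConjSymm₃ (fun q p₁ p₂ => f q p₁ p₂ + g q p₁ p₂) :=
  fun q p₁ p₂ => by simp only [hf q p₁ p₂, hg q p₁ p₂, map_add]
/-- three-slot differences. [folklore] -/ theorem ConjSymm₃.sub (hf : ConjSymm₃ f) (hg : ConjSymm₃ g) : ConjSymm₃ (fun q p₁ p₂ => f q p₁ p₂ - g q p₁ p₂) :=
  fun q p₁ p₂ => by simp only [hf q p₁ p₂, hg q p₁ p₂, map_sub]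
/-- three-slot products. [folklore] -/ theorem ConjSymm₃.mul (hf : ConjSymm₃ f) (hg : ConjSymm₃ g) : ConjSymm₃ (fun q p₁ p₂ => f q p₁ p₂ * g q p₁ p₂) :=
  fun q p₁ p₂ => by simp only [hf q p₁ p₂, hg q p₁ p₂, map_mul]
/-- three-slot natural powers. [folklore] -/ theorem ConjSymm₃.pow (hf : ConjSymm₃ f) (k : ℕ) : ConjSymm₃ (fun q p₁ p₂ => f q p₁ p₂ ^ k) :=
  fun q p₁ p₂ => by simp only [hf q p₁ p₂, map_pow]

/-- phases `e^{f}` of symmetric exponents (Bloch factors `e^{±i p·R}`: exponent `R_μ·(I p₁) + R_ν·(I p₂)`). [folklore] -/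
theorem ConjSymm₃.cexp (hf : ConjSymm₃ f) : ConjSymm₃ (fun q p₁ p₂ => cexp (f q p₁ p₂)) :=
  fun q p₁ p₂ => by simp only [hf q p₁ p₂]; exact Complex.exp_conj _

/-- three-slot finite sums. [folklore] -/ theorem ConjSymm₃.sum {α : Type*} (s : Finset α) {H : α → (ι → ℂ) → ℂ → ℂ → ℂ} (h : ∀ a ∈ s, ConjSymm₃ (H a)) :
    ConjSymm₃ (fun q p₁ p₂ => ∑ a ∈ s, H a q p₁ p₂) := fun q p₁ p₂ => by
  rw [map_sum]; exact Finset.sum_congr rfl fun a ha => h a ha q p₁ p₂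

variable {A A' B C D : (ι → ℂ) → ℂ → ℂ → Matrix n n ℂ}

/-- three-slot scalar multiples by a `ConjSymm₃` scalar family. [folklore] -/ theorem MatConjSymm₃.smul {A : (ι → ℂ) → ℂ → ℂ → Matrix m n ℂ} (hA : MatConjSymm₃ A) (hg : ConjSymm₃ g) :
    MatConjSymm₃ (fun q p₁ p₂ => g q p₁ p₂ • A q p₁ p₂) :=
  matConjSymm₃_iff.mpr ((matConjSymm₃_iff.mp hA).smul (conjSymm₃_iff.mp hg))

/-- three-slot sums of matrix families. [folklore] -/ theorem MatConjSymm₃.add {A B : (ι → ℂ) → ℂ → ℂ → Matrix m n ℂ} (hA : MatConjSymm₃ A) (hB : MatConjSymm₃ B) :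
    MatConjSymm₃ (fun q p₁ p₂ => A q p₁ p₂ + B q p₁ p₂) :=
  matConjSymm₃_iff.mpr ((matConjSymm₃_iff.mp hA).add (matConjSymm₃_iff.mp hB))
/-- three-slot differences of matrix families. [folklore] -/ theorem MatConjSymm₃.sub {A B : (ι → ℂ) → ℂ → ℂ → Matrix m n ℂ} (hA : MatConjSymm₃ A) (hB : MatConjSymm₃ B) :
    MatConjSymm₃ (fun q p₁ p₂ => A q p₁ p₂ - B q p₁ p₂) :=
  matConjSymm₃_iff.mpr ((matConjSymm₃_iff.mp hA).sub (matConjSymm₃_iff.mp hB))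

/-- three-slot finite sums of matrix families. [folklore] -/ theorem MatConjSymm₃.sum {α : Type*} (s : Finset α) {H : α → (ι → ℂ) → ℂ → ℂ → Matrix m n ℂ}
    (h : ∀ a ∈ s, MatConjSymm₃ (H a)) : MatConjSymm₃ (fun q p₁ p₂ => ∑ a ∈ s, H a q p₁ p₂) :=
  matConjSymm₃_iff.mpr (MatConjSymm.sum s fun a ha => matConjSymm₃_iff.mp (h a ha))

/-- joint character sums `Σ_a φ_a(q; p₁, p₂) • K_a` against self-conjugate tables (vertex families with Bloch factors). [folklore] -/
theorem matConjSymm₃_sum_smul {α : Type*} (s : Finset α) {φ : α → (ι → ℂ) → ℂ → ℂ → ℂ} {K : α → Matrix m n ℂ}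
    (hφ : ∀ a ∈ s, ConjSymm₃ (φ a)) (hK : ∀ a ∈ s, (K a).map conj = K a) :
    MatConjSymm₃ (fun q p₁ p₂ => ∑ a ∈ s, φ a q p₁ p₂ • K a) :=
  MatConjSymm₃.sum s fun a ha => (MatConjSymm.to₃ (matConjSymm_const (ι := ι) (hK a ha))).smul (hφ a ha)

/-- three-slot products of (rectangular) matrix families. [folklore] -/ theorem MatConjSymm₃.mul [Fintype n] {o : Type*} {A : (ι → ℂ) → ℂ → ℂ → Matrix m n ℂ}
    {B : (ι → ℂ) → ℂ → ℂ → Matrix n o ℂ} (hA : MatConjSymm₃ A) (hB : MatConjSymm₃ B) :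
    MatConjSymm₃ (fun q p₁ p₂ => A q p₁ p₂ * B q p₁ p₂) :=
  matConjSymm₃_iff.mpr ((matConjSymm₃_iff.mp hA).mul (matConjSymm₃_iff.mp hB))

/-- three-slot inverses — no determinant hypothesis. [folklore] -/ theorem MatConjSymm₃.inv [Fintype n] [DecidableEq n] (hA : MatConjSymm₃ A) :
    MatConjSymm₃ (fun q p₁ p₂ => (A q p₁ p₂)⁻¹) :=
  matConjSymm₃_iff.mpr (matConjSymm₃_iff.mp hA).inv

/-- three-slot traces. [folklore] -/ theorem MatConjSymm₃.trace [Fintype n] (hA : MatConjSymm₃ A) : ConjSymm₃ (fun q p₁ p₂ => (A q p₁ p₂).trace) :=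
  conjSymm₃_iff.mpr (matConjSymm₃_iff.mp hA).trace

/-- **THE JET INTEGRAND**: the one-loop form with three-slot families (`A` = `k₀(q)` via `to₃`, `A′` = `k₀(q − p)` via `shift₃`,
vertex families via `matConjSymm₃_sum_smul`) is JOINTLY conjugate-reflection symmetric. [folklore] -/
theorem conjSymm₃_oneLoopForm [Fintype n] [DecidableEq n] (hA : MatConjSymm₃ A) (hA' : MatConjSymm₃ A') (hB : MatConjSymm₃ B)
    (hC : MatConjSymm₃ C) (hD : MatConjSymm₃ D) :
    ConjSymm₃ (fun q p₁ p₂ => ((A q p₁ p₂)⁻¹ * B q p₁ p₂).trace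
      - ((A q p₁ p₂)⁻¹ * C q p₁ p₂ * (A' q p₁ p₂)⁻¹ * D q p₁ p₂).trace) :=
  ((hA.inv.mul hB).trace).sub ((((hA.inv.mul hC).mul hA'.inv).mul hD).trace)

end ThreeSlot

/-! ## §5 The jet functional inherits the symmetry (two sign flips cancel) -/

section Jet

/-- `d/dz conj h(−z̄) = −conj h′(−z̄)`, unconditionally (both sides vanish where `h` is not differentiable). [folklore] -/
theorem deriv_conj_comp_conjNeg (h : ℂ → ℂ) (z : ℂ) :
    deriv (fun w => conj (h (-conj w))) z = -conj (deriv h (-conj z)) := by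
  have e : (fun w => conj (h (-conj w))) = conj ∘ (fun w => h (-w)) ∘ conj := rfl
  rw [e, deriv_conj_conj]
  simp only [Function.comp_apply, deriv_comp_neg, map_neg]

variable {d : ℕ}

/-- **`jetFunctional f (−q̄) = conj (jetFunctional f q)`** for a JOINTLY symmetric jet integrand: the `[p₁p₂]`-coefficient is even in
`p`, so the two sign flips of §5's derivative lemma cancel and `conj (1/2) = 1/2`. [folklore] -/
theorem conjSymm_jetFunctional {f : (Fin (d + 1) → ℂ) → ℂ → ℂ → ℂ} (hf : ConjSymm₃ f) :
    ConjSymm (jetFunctional f) := fun q => by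
  obtain ⟨k, hk⟩ : ∃ k : ℂ → ℂ, k = fun u => -(fun p₁ => deriv (f q p₁) 0) u := ⟨_, rfl⟩
  have h₁ : ∀ p₁, f (conjNeg q) p₁ = fun p₂ => conj (f q (-conj p₁) (-conj p₂)) := fun p₁ => by
    funext p₂
    have := hf q (-conj p₁) (-conj p₂)
    simpa only [map_neg, Complex.conj_conj, neg_neg] using this
  have h₂ : (fun p₁ => deriv (f (conjNeg q) p₁) 0) = fun p₁ => conj (k (-conj p₁)) := by
    funext p₁
    rw [h₁ p₁, deriv_conj_comp_conjNeg, map_zero, neg_zero, hk]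
    simp only [map_neg]
  have h₃ : deriv k 0 = -deriv (fun p₁ => deriv (f q p₁) 0) 0 := by rw [hk, deriv.fun_neg]
  unfold jetFunctional
  rw [h₂, deriv_conj_comp_conjNeg, map_zero, neg_zero, h₃, map_neg, neg_neg, map_mul, map_div₀, map_one, map_ofNat]

/-- **`hsym` FOR THE JET ANCHOR** (`CapRowsLatticeJet.rowsOfJetCode16E₂`, `G := jetFunctional f`), an5's binder verbatim. [folklore] -/
theorem jet_hsym {f : (Fin (d + 1) → ℂ) → ℂ → ℂ → ℂ} (hf : ConjSymm₃ f) :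
    ∀ p : Fin (d + 1) → ℝ, jetFunctional f (ofRealVec (-p)) = conj (jetFunctional f (ofRealVec p)) :=
  (conjSymm_jetFunctional hf).hsym

/-- … and the real-zone form for `GAN24/LatticeKernelReality` (the jet functional has a REAL lattice kernel). [folklore] -/
theorem jet_realZone {f : (Fin (d + 1) → ℂ) → ℂ → ℂ → ℂ} (hf : ConjSymm₃ f) :
    ∀ s ∈ BZ (d + 1), conj (jetFunctional f (ofRealVec (-s))) = jetFunctional f (ofRealVec s) :=
  (conjSymm_jetFunctional hf).realZone

end Jet

end Summit.QuantumFields.BalabanUV.Beta.ConjReflectionAlgebra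

end
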